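import Summits.Ventures.Crystal3D.Theorems.StickyWulffConstantGenericWallFloorBarlowWindowFamily
import HarnessLib

/-!
# Window-family walkers END ABOVE the complete window (the «not low» input of F4's `ends ∈ PAY`)
# (crux `GenericWallFloor`, stmt-Ventures-19480, line `WallLedgerG`; lane T's F4, cf-p1 §86(58) BA)

HONEST FRAMING. Venture `Summits/Ventures/Crystal3D` (cell `crystal3d-full`), helper `--supports` the crux `GenericWallFloor`
(stmt-Ventures-19480) of `route-Ventures-StickyWulffConstant`, registered line `WallLedgerG`, open stub `stub_twoSlabAdhesion`.
Rung credit only; F-C1 not moved; NOT the stub.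

Companion of `windowFamily_walkRun_injOn` (`…BarlowWindowFamily`), single start: with the same data (canonical states / model
steps of `…BarlowPrefix`, steps rising `≥ δ > 0` along `z`, complete region `R` containing every site of height `[H, Ztop]` within
`(Ztop − H)/δ + 1` of the start, `Ztop ≥ H + 1`, start height `≥ H`, valid canonical start state) and fuel
`N ≥ ⌈(Ztop − H)/δ⌉₊ + 1`, the walker is ABOVE `Ztop` at time `N`:

* **`windowStart_end_height_gt`** — `Ztop < ⟪(walkRun X z N start).1, z⟫`.
(The zigzag leaves the height window within `⌈(Ztop − H)/δ⌉₊ + 1` steps — prefix lemma up to the first site above `Ztop` — and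
heights never decrease afterwards.)  With `Ztop = −R₀ − 2` this is the hypothesis `hlow` of `walkEnd_mem_PAY_barlow`.
WHAT THIS IS NOT: not F4; F-C1 not moved.
-/

noncomputable section

namespace Summit.Ventures.Crystal3D.Theorems

open Finset
open Literature.MathematicalPhysics.StatisticalMechanics
open scoped InnerProductSpace

variable {X : Finset (EuclideanSpace ℝ (Fin 3))}

section Moved

variable (σ : ℤ → ℤ) (L : EuclideanSpace ℝ (Fin 3) ≃ₗᵢ[ℝ] EuclideanSpace ℝ (Fin 3)) (s₀ z v₀ : EuclideanSpace ℝ (Fin 3))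
  (canon : ℤ → EuclideanSpace ℝ (Fin 3) → EuclideanSpace ℝ (Fin 3) × List WalkEntry) (ms : ℤ → EuclideanSpace ℝ (Fin 3))

open scoped Classical in
/-- **A window-family walker ends above the window.**  See the module docstring. -/
theorem windowStart_end_height_gt (hσ : IsHaggSeq σ) (hX₁ : ∀ p ∈ X, ∀ q ∈ X, p ≠ q → 1 ≤ dist p q)
    {s₁ : EuclideanSpace ℝ (Fin 3)} (hs₁ : s₁ ∈ fccSlots) (hcert : ExactOnly 0 (fccSlots.filter fun w => 0 < ⟪w, s₁⟫_ℝ))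
    (hz : ‖z‖ = 1) (hv₀ : v₀ ∈ fccSlots) (hv₀2 : v₀ 2 = Real.sqrt (2 / 3))
    (hcanon₁ : ∀ m t, σ (m - 1) = 1 → canon m t = (t, [⟨L, v₀, 0⟩]))
    (hcanon₂ : ∀ m t, σ (m - 1) = -1 → canon m t =
      (t, [⟨twinFrame L (L (EuclideanSpace.single (2 : Fin 3) (1 : ℝ))),
            bestCapper (twinFrame L (L (EuclideanSpace.single (2 : Fin 3) (1 : ℝ)))) (L (EuclideanSpace.single (2 : Fin 3) (1 : ℝ))) z,
            L (EuclideanSpace.single (2 : Fin 3) (1 : ℝ))⟩, ⟨L, v₀, 0⟩]))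
    (hms₁ : ∀ m, σ m = 1 → ms m = v₀)
    (hms₂ : ∀ m, σ m = -1 → ms m =
      basalMirror (bestCapper (twinFrame L (L (EuclideanSpace.single (2 : Fin 3) (1 : ℝ)))) (L (EuclideanSpace.single (2 : Fin 3) (1 : ℝ))) z))
    {δ : ℝ} (hδ0 : 0 < δ) (hδ : ∀ m, δ ≤ ⟪L (ms m), z⟫_ℝ)
    (R : Set (EuclideanSpace ℝ (Fin 3)))
    (hR : ∀ m i j : ℤ, barlowPos 1 (Real.sqrt (2 / 3)) σ m i j ∈ R →
      ∀ q ∈ barlowStacking 1 (Real.sqrt (2 / 3)) σ, dist q (barlowPos 1 (Real.sqrt (2 / 3)) σ m i j) ≤ 1 → L q + s₀ ∈ X)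
    (H Ztop : ℝ) (hHZ : H + 1 ≤ Ztop) (m a b : ℤ)
    (hRin : ∀ m' a' b' : ℤ,
      H ≤ ⟪L (barlowPos 1 (Real.sqrt (2 / 3)) σ m' a' b') + s₀, z⟫_ℝ →
      ⟪L (barlowPos 1 (Real.sqrt (2 / 3)) σ m' a' b') + s₀, z⟫_ℝ ≤ Ztop →
      ‖barlowPos 1 (Real.sqrt (2 / 3)) σ m' a' b' - barlowPos 1 (Real.sqrt (2 / 3)) σ m a b‖ ≤ (Ztop - H) / δ + 1 →
      barlowPos 1 (Real.sqrt (2 / 3)) σ m' a' b' ∈ R)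
    (hlow : H ≤ ⟪L (barlowPos 1 (Real.sqrt (2 / 3)) σ m a b) + s₀, z⟫_ℝ)
    (hvalid : WalkInv X z (canon m (L (barlowPos 1 (Real.sqrt (2 / 3)) σ m a b) + s₀)) ∧
      StackWF z (canon m (L (barlowPos 1 (Real.sqrt (2 / 3)) σ m a b) + s₀)).2)
    {N : ℕ} (hN : ⌈(Ztop - H) / δ⌉₊ + 1 ≤ N) :
    Ztop < ⟪(walkRun X z N (canon m (L (barlowPos 1 (Real.sqrt (2 / 3)) σ m a b) + s₀))).1, z⟫_ℝ := by
  set p₀ := barlowPos 1 (Real.sqrt (2 / 3)) σ m a b with hp₀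
  set site : ℕ → EuclideanSpace ℝ (Fin 3) := fun k => p₀ + ∑ k' ∈ Finset.range k, ms (m + k') with hsite
  set ht : EuclideanSpace ℝ (Fin 3) → ℝ := fun p => ⟪L p + s₀, z⟫_ℝ with hht
  have hpos : ∀ m' t, (canon m' t).1 = t := by
    intro m' t
    rcases hσ (m' - 1) with h | h
    · rw [hcanon₁ m' t h]
    · rw [hcanon₂ m' t h]
  have hms : ∀ m', ‖ms m'‖ = 1 := by
    intro m'
    rcases hσ m' with h | h
    · rw [hms₁ m' h, norm_eq_one_of_mem_fccSlots hv₀]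
    · rw [hms₂ m' h, LinearIsometryEquiv.norm_map, norm_eq_one_of_mem_fccSlots (bestCapper_nabla_slot L z).1]
  have hgrow : ∀ k : ℕ, ht p₀ + k * δ ≤ ht (site k) := fun k => by
    simp only [hht, hsite]; exact height_site_ge L s₀ z ms hδ p₀ m k
  -- exit index
  set K₀ : ℕ := ⌈(Ztop - H) / δ⌉₊ + 1 with hK₀
  have hK₀gt : (Ztop - H) / δ < ((K₀ : ℕ) : ℝ) := by
    rw [hK₀]; push_cast; have := Nat.le_ceil ((Ztop - H) / δ); linarith
  have habove : Ztop < ht (site K₀) := by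
    refine lt_of_lt_of_le ?_ (hgrow K₀)
    have h2 : Ztop - H < (K₀ : ℝ) * δ := by rw [div_lt_iff₀ hδ0] at hK₀gt; linarith
    show Ztop < ht p₀ + K₀ * δ
    have h1 : H ≤ ht p₀ := hlow
    linarith
  have hex : ∃ k : ℕ, Ztop < ht (site k) := ⟨K₀, habove⟩
  set n : ℕ := Nat.find hex with hn
  have hn_spec : Ztop < ht (site n) := Nat.find_spec hex
  have hn_min : ∀ k < n, ht (site k) ≤ Ztop := fun k hk => by
    have := Nat.find_min hex hk; push Not at this; exact this
  have hn_le : n ≤ K₀ := Nat.find_le habove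
  -- the prefix stays in `R`
  have hin : ∀ k < n, site k ∈ R := by
    intro k hk
    obtain ⟨a', b', hab⟩ := site_mem_barlowLayer σ L z v₀ ms hσ hv₀ hv₀2 hms₁ hms₂ m a b k
    have hab' : site k = barlowPos 1 (Real.sqrt (2 / 3)) σ (m + k) a' b' := hab
    have f1 : H ≤ ht (site k) := by
      have h1 := hgrow k; have h3 : (0 : ℝ) ≤ k * δ := by positivity
      have h2 : H ≤ ht p₀ := hlow
      linarith
    have f2 : ht (site k) ≤ Ztop := hn_min k hk
    have f3 : ‖site k - p₀‖ ≤ (Ztop - H) / δ + 1 := by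
      have hd : site k - p₀ = ∑ k' ∈ Finset.range k, ms (m + k') := by simp only [hsite]; abel
      rw [hd]
      calc ‖∑ k' ∈ Finset.range k, ms (m + k')‖ ≤ ∑ k' ∈ Finset.range k, ‖ms (m + k')‖ := norm_sum_le _ _
        _ = k := by simp [hms]
        _ ≤ (Ztop - H) / δ + 1 := by
            have hk' : (k : ℝ) + 1 ≤ (n : ℕ) := by exact_mod_cast hk
            have hni : ((n : ℕ) : ℝ) ≤ K₀ := by exact_mod_cast hn_le
            have hK₀le : ((K₀ : ℕ) : ℝ) ≤ (Ztop - H) / δ + 2 := by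
              rw [hK₀]; push_cast
              have := Nat.ceil_lt_add_one (div_nonneg (by linarith : (0 : ℝ) ≤ Ztop - H) hδ0.le); linarith
            linarith
    rw [hab'] at f1 f2 f3 ⊢
    exact hRin (m + k) a' b' f1 f2 f3
  -- the prefix lemma up to the exit site, then monotone heights
  obtain ⟨hrun, -⟩ := walkRun_canon_prefix σ L s₀ z v₀ canon ms hσ hX₁ hv₀ hv₀2 hcanon₁ hcanon₂ hms₁ hms₂ R hR n m a b hin
  have hnN : n ≤ N := hn_le.trans hN
  obtain ⟨d, rfl⟩ := Nat.exists_eq_add_of_le hnN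
  rw [walkRun_add', hrun]
  have hvalN := walkRun_valid hX₁ hs₁ hcert hz n hvalid.1 hvalid.2
  rw [hrun] at hvalN
  have hge := walkRun_height_ge hX₁ hs₁ hcert hz d _ hvalN.1
  rw [hpos] at hge
  exact lt_of_lt_of_le hn_spec hge

end Moved

end Summit.Ventures.Crystal3D.Theorems

end
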